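import Literature.Analysis.FluidPDE.PassiveVectorVarTensorEnergyIdentity
import Literature.Analysis.FunctionSpaces.TorusSpectralWeakDerivative
import Mathlib.Analysis.MeanInequalities
import HarnessLib

/-!
# Weak gradients on `T^d` on the Fourier side: the `L²` mass of an honest weak gradient is the spectral dissipation, and the
# HIGH-MODE PAIRING (Poincaré) bound `|∫⟪v, h⟫| ≤ ‖∇v‖₂ ‖h‖₂ / (2πK)` for `h` supported on frequencies `|k| ≥ K`

Analysis/FluidPDE proof file (everything proved; no definitions, no named facts, no `sorry`; placed next to `PassiveVectorVarTensorEnergyIdentity`, whose Fourier-side lemma it reads coordinatewise).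

For a real vector field `v ∈ L²(T^d; ℝ^d)` with honest weak partial derivatives `D j ∈ L²` (`Torus.HasWeakPartialDeriv j v (D j)`,
Evans §5.2.1) the Fourier coefficients of the components of `D j` are `2πi kⱼ v̂ᵢ(k)` (Grafakos, Prop. 3.2.6 (8) read through the weak
identity tested with the characters — `Torus.mFourierCoeff_complexify_eq_of_hasWeakPartialDeriv` of `PassiveVectorVarTensorEnergyIdentity`), hence the spectral dissipation
`Torus.eGradNormSq v = 4π² ∑ₖ |k|² ‖v̂(k)‖²` IS `∫ ∑ⱼ ‖D j‖²` (`eGradNormSq_eq_lintegral_of_hasWeakPartialDeriv`; converse direction of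
`Torus.lintegral_sum_enorm_sq_eq_eGradNormSq`, which ASSUMES the coefficient relation).  Consequently (Parseval polarised,
`Torus.hasSum_re_inner_mFourierCoeff_complexify`, and Cauchy–Schwarz on `ℓ²`) a field `h ∈ L²` whose Fourier coefficients vanish on the
ball `|k|² < K²` pairs with `v` through the high modes only:
`|∫⟪v, h⟫| ≤ √(eGradNormSq v) · ‖h‖₂ / (2πK)` (`abs_integral_inner_le_of_mFourierCoeff_eq_zero_of_freqNormSq_lt`) — the Poincaré inequality
for the high-frequency part, in PAIRING form (no projection operator needed), with the weak-gradient reading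
`|∫⟪v, h⟫| ≤ √(∫∑ⱼ‖D j‖²) · ‖h‖₂ / (2πK)` (`abs_integral_inner_le_of_hasWeakPartialDeriv_of_freqNormSq_lt`).

Consumer: cell `ad-ideate`, K1L_D `stmt-AnomalousDissipation-27980`, tool (T1) of `HOME/ad-k1loc-p3/S2-NOTE-p3g12.md` §3 (the bandwidth
estimate paying high-wavenumber pairings of a weak solution in its dissipation).

## Mathlib / tree search
Tree: `Torus.HasWeakPartialDeriv`, `Torus.mFourierCoeff_complexify_eq_of_hasWeakPartialDeriv` (`PassiveVectorVarTensorEnergyIdentity`),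
`Torus.lintegral_sum_enorm_sq_eq_eGradNormSq`, `Torus.eGradNormSq_eq_tsum`, `Torus.enorm_sq_eq_sum_euclidean` (`TorusSpectralWeakDerivative`),
`Torus.hasSum_re_inner_mFourierCoeff_complexify`, `Torus.hasSum_sq_norm_mFourierCoeff_complexify`, `Torus.memLp_ofReal_apply`,
`Torus.mFourierCoeff_complexify_apply` (`TorusVectorParseval`, `TorusSobolevNorm`). Mathlib: `Real.inner_le_Lp_mul_Lq_hasSum_of_nonneg`,
`HasSum.norm_le_of_bounded`, `eval_integral_piLp`, `integral_complex_ofReal`.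

## References
* L. Grafakos, *Classical Fourier Analysis*, 3rd ed., GTM 249 (Springer 2014), Prop. 3.2.6 (8), Prop. 3.2.7 (3). [`Grafakos2014`]
* L. C. Evans, *Partial Differential Equations*, 2nd ed. (AMS 2010), §5.2.1, §5.8.4 Thm. 8. [`Evans2010`]
-/

open MeasureTheory Set Filter Topology UnitAddTorus
open scoped ENNReal NNReal ComplexConjugate

noncomputable section

namespace Literature.Analysis.FluidPDE

namespace Torus

open Literature.Analysis.FunctionSpaces Literature.Analysis.FunctionSpaces.Torus

variable {d : Type*} [Fintype d] [DecidableEq d]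

/-! ## §1 Fourier coefficients and `L²` mass of an honest weak gradient -/

/-- **Fourier coefficients of an honest `L²` weak gradient, coordinatewise**: `𝓕((D j)ᵢ)(k) = 2πi kⱼ · 𝓕(vᵢ)(k)` (coordinate `i` of
`Torus.mFourierCoeff_complexify_eq_of_hasWeakPartialDeriv`). [cite: Grafakos2014, Prop. 3.2.6 (8)] -/
theorem mFourierCoeff_coord_of_hasWeakPartialDeriv {j : d} {v D : UnitAddTorus d → EuclideanSpace ℝ d}
    (hv : MemLp v 2 volume) (hD : MemLp D 2 volume) (h : HasWeakPartialDeriv j v D) (i : d) (k : d → ℤ) :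
    mFourierCoeff (fun x => (D x i : ℂ)) k = (2 * Real.pi * Complex.I * (k j) : ℂ) * mFourierCoeff (fun x => (v x i : ℂ)) k := by
  have hvi : Integrable v volume := hv.integrable one_le_two
  have hDi : Integrable D volume := hD.integrable one_le_two
  have h1 := congrArg (fun z : EuclideanSpace ℂ d => z i) (mFourierCoeff_complexify_eq_of_hasWeakPartialDeriv hvi hDi h k)
  simp only [PiLp.smul_apply, smul_eq_mul] at h1
  rw [mFourierCoeff_complexify_apply hDi k i, mFourierCoeff_complexify_apply hvi k i] at h1
  exact h1

omit [DecidableEq d] in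
/-- The squared norm of a vector of `ℝ^d` in `ℝ≥0∞` through its complexified coordinates: `‖w‖ₑ² = ∑ᵢ ‖(wᵢ : ℂ)‖ₑ²`. [folklore] -/
private theorem enorm_sq_eq_sum_ofReal_coord (w : EuclideanSpace ℝ d) : ‖w‖ₑ ^ 2 = ∑ i, ‖(w i : ℂ)‖ₑ ^ 2 := by
  rw [← ofReal_norm, ← ENNReal.ofReal_pow (norm_nonneg _), EuclideanSpace.norm_sq_eq, ENNReal.ofReal_sum_of_nonneg fun i _ => sq_nonneg _]
  refine Finset.sum_congr rfl fun i _ => ?_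
  rw [← ofReal_norm, ← ENNReal.ofReal_pow (norm_nonneg _), Complex.norm_real]

/-- **The `L²` mass of an honest weak gradient is the spectral dissipation**: `eGradNormSq v = ∫ ∑ⱼ ‖D j‖²` when `D j ∈ L²` is a weak
`j`-th partial derivative of `v ∈ L²` for every `j`. [cite: Grafakos2014, Prop. 3.2.7 (3)] -/
theorem eGradNormSq_eq_lintegral_of_hasWeakPartialDeriv {v : UnitAddTorus d → EuclideanSpace ℝ d}
    {D : d → UnitAddTorus d → EuclideanSpace ℝ d} (hv : MemLp v 2 volume) (hD : ∀ j, MemLp (D j) 2 volume)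
    (h : ∀ j, HasWeakPartialDeriv j v (D j)) :
    eGradNormSq v = ∫⁻ x, ∑ j, ‖D j x‖ₑ ^ 2 := by
  have key := lintegral_sum_enorm_sq_eq_eGradNormSq hv (g := fun i j x => (D j x i : ℂ)) (fun i j => memLp_ofReal_apply (hD j) i)
    (fun i j k => mFourierCoeff_coord_of_hasWeakPartialDeriv hv (hD j) (h j) i k)
  rw [← key]
  refine lintegral_congr fun x => ?_
  rw [Finset.sum_comm]
  exact Finset.sum_congr rfl fun j _ => (enorm_sq_eq_sum_ofReal_coord (D j x)).symm

/-! ## §2 The high-mode pairing bound -/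

omit [DecidableEq d] in
/-- The weighted coefficient series of the spectral dissipation in `ℝ`: if `eGradNormSq v < ∞` then `∑ₖ |k|² ‖v̂(k)‖²` has the sum
`(eGradNormSq v).toReal / (4π²)`. [cite: Grafakos2014, Prop. 3.2.7 (3)] -/
theorem hasSum_freqNormSq_mul_sq_norm_mFourierCoeff {v : UnitAddTorus d → EuclideanSpace ℝ d} (hgrad : eGradNormSq v ≠ ⊤) :
    HasSum (fun k : d → ℤ => freqNormSq k * ‖mFourierCoeff (EuclideanSpace.complexify ∘ v) k‖ ^ 2)
      ((eGradNormSq v).toReal / (4 * Real.pi ^ 2)) := by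
  set T : ℝ≥0∞ := ∑' k : d → ℤ, ENNReal.ofReal (freqNormSq k) * ‖mFourierCoeff (EuclideanSpace.complexify ∘ v) k‖ₑ ^ 2 with hT
  have hE : eGradNormSq v = ENNReal.ofReal (4 * Real.pi ^ 2) * T := eGradNormSq_eq_tsum v
  have hπ : 0 < 4 * Real.pi ^ 2 := by positivity
  have hTtop : T ≠ ⊤ := by
    intro h
    rw [h, ENNReal.mul_top (by rw [Ne, ENNReal.ofReal_eq_zero, not_le]; exact hπ)] at hE
    exact hgrad hE
  have hterm : ∀ k : d → ℤ, ENNReal.ofReal (freqNormSq k) * ‖mFourierCoeff (EuclideanSpace.complexify ∘ v) k‖ₑ ^ 2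
      = ENNReal.ofReal (freqNormSq k * ‖mFourierCoeff (EuclideanSpace.complexify ∘ v) k‖ ^ 2) := fun k => by
    rw [← ofReal_norm, ← ENNReal.ofReal_pow (norm_nonneg _), ← ENNReal.ofReal_mul (by unfold freqNormSq; positivity)]
  have hnn : ∀ k : d → ℤ, 0 ≤ freqNormSq k * ‖mFourierCoeff (EuclideanSpace.complexify ∘ v) k‖ ^ 2 :=
    fun k => by unfold freqNormSq; positivity
  have hsum : HasSum (fun k : d → ℤ => freqNormSq k * ‖mFourierCoeff (EuclideanSpace.complexify ∘ v) k‖ ^ 2) T.toReal := by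
    have h1 : ∑' k : d → ℤ, ENNReal.ofReal (freqNormSq k * ‖mFourierCoeff (EuclideanSpace.complexify ∘ v) k‖ ^ 2) ≠ ⊤ := by
      rw [show (∑' k : d → ℤ, ENNReal.ofReal (freqNormSq k * ‖mFourierCoeff (EuclideanSpace.complexify ∘ v) k‖ ^ 2)) = T from
        (tsum_congr hterm).symm]
      exact hTtop
    have h2 := (ENNReal.summable_toReal h1)
    have h3 : (fun k : d → ℤ => (ENNReal.ofReal (freqNormSq k * ‖mFourierCoeff (EuclideanSpace.complexify ∘ v) k‖ ^ 2)).toReal)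
        = fun k => freqNormSq k * ‖mFourierCoeff (EuclideanSpace.complexify ∘ v) k‖ ^ 2 := funext fun k => ENNReal.toReal_ofReal (hnn k)
    rw [h3] at h2
    have h4 := h2.hasSum
    have h5 : ∑' k : d → ℤ, freqNormSq k * ‖mFourierCoeff (EuclideanSpace.complexify ∘ v) k‖ ^ 2 = T.toReal := by
      rw [hT, ← tsum_congr fun k => (hterm k).symm, ENNReal.tsum_toReal_eq (fun k => ENNReal.ofReal_ne_top)]
      exact tsum_congr fun k => (ENNReal.toReal_ofReal (hnn k)).symm
    rwa [h5] at h4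
  have hval : (eGradNormSq v).toReal / (4 * Real.pi ^ 2) = T.toReal := by
    rw [hE, ENNReal.toReal_mul, ENNReal.toReal_ofReal hπ.le]
    field_simp
  rw [hval]; exact hsum

omit [DecidableEq d] in
/-- **HIGH-MODE PAIRING (Poincaré) BOUND, spectral form.**  If `v, h ∈ L²(T^d; ℝ^d)`, `eGradNormSq v < ∞`, and the Fourier coefficients of `h`
vanish on the ball `|k|² < K²` (`K > 0`), then  `|∫⟪v, h⟫| ≤ √((eGradNormSq v).toReal) / (2πK) · √(∫‖h‖²)`.
[cite: Grafakos2014, Prop. 3.2.7 (3)] -/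
theorem abs_integral_inner_le_of_mFourierCoeff_eq_zero_of_freqNormSq_lt {v h : UnitAddTorus d → EuclideanSpace ℝ d}
    (hv : MemLp v 2 volume) (hh : MemLp h 2 volume) (hgrad : eGradNormSq v ≠ ⊤) {K : ℝ} (hK : 0 < K)
    (hlow : ∀ k : d → ℤ, freqNormSq k < K ^ 2 → mFourierCoeff (EuclideanSpace.complexify ∘ h) k = 0) :
    |∫ x, inner ℝ (v x) (h x)| ≤ Real.sqrt (eGradNormSq v).toReal / (2 * Real.pi * K) * Real.sqrt (∫ x, ‖h x‖ ^ 2) := by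
  set a : (d → ℤ) → ℝ := fun k => ‖mFourierCoeff (EuclideanSpace.complexify ∘ v) k‖ with ha
  set b : (d → ℤ) → ℝ := fun k => ‖mFourierCoeff (EuclideanSpace.complexify ∘ h) k‖ with hb
  set c : (d → ℤ) → ℝ := fun k => Real.sqrt (freqNormSq k) * a k / K with hc
  have ha0 : ∀ k, 0 ≤ a k := fun k => norm_nonneg _
  have hb0 : ∀ k, 0 ≤ b k := fun k => norm_nonneg _
  have hc0 : ∀ k, 0 ≤ c k := fun k => by positivity
  -- the two `ℓ²` sums
  set A : ℝ := Real.sqrt ((eGradNormSq v).toReal / (4 * Real.pi ^ 2)) / K with hA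
  set B : ℝ := Real.sqrt (∫ x, ‖h x‖ ^ 2) with hB
  have hA0 : 0 ≤ A := by positivity
  have hB0 : 0 ≤ B := Real.sqrt_nonneg _
  have hgrad' : 0 ≤ (eGradNormSq v).toReal / (4 * Real.pi ^ 2) := by positivity
  have hcsum : HasSum (fun k => c k ^ (2 : ℝ)) (A ^ (2 : ℝ)) := by
    have h1 := (hasSum_freqNormSq_mul_sq_norm_mFourierCoeff hgrad).div_const (K ^ 2)
    simp only [Real.rpow_two]
    have e : ∀ k, c k ^ 2 = freqNormSq k * ‖mFourierCoeff (EuclideanSpace.complexify ∘ v) k‖ ^ 2 / K ^ 2 := fun k => by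
      rw [hc]; simp only
      rw [div_pow, mul_pow, Real.sq_sqrt (by unfold freqNormSq; positivity)]
    have eA : A ^ 2 = (eGradNormSq v).toReal / (4 * Real.pi ^ 2) / K ^ 2 := by
      rw [hA, div_pow, Real.sq_sqrt hgrad']
    rw [show (fun k => c k ^ 2) = fun k => freqNormSq k * ‖mFourierCoeff (EuclideanSpace.complexify ∘ v) k‖ ^ 2 / K ^ 2 from funext e, eA]
    exact h1
  have hbsum : HasSum (fun k => b k ^ (2 : ℝ)) (B ^ (2 : ℝ)) := by
    simp only [Real.rpow_two]
    rw [hB, Real.sq_sqrt (integral_nonneg fun x => sq_nonneg _)]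
    exact hasSum_sq_norm_mFourierCoeff_complexify hh
  obtain ⟨C, _, hCAB, hCsum⟩ := Real.inner_le_Lp_mul_Lq_hasSum_of_nonneg Real.HolderConjugate.two_two hA0 hB0 hc0 hb0 hcsum hbsum
  -- termwise domination of the polarised Parseval series
  have hS := hasSum_re_inner_mFourierCoeff_complexify hv hh
  have hdom : ∀ k : d → ℤ, ‖(inner ℂ (mFourierCoeff (EuclideanSpace.complexify ∘ v) k) (mFourierCoeff (EuclideanSpace.complexify ∘ h) k)).re‖
      ≤ c k * b k := by
    intro k
    have h1 : ‖(inner ℂ (mFourierCoeff (EuclideanSpace.complexify ∘ v) k) (mFourierCoeff (EuclideanSpace.complexify ∘ h) k)).re‖ ≤ a k * b k :=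
      (Complex.abs_re_le_norm _).trans (norm_inner_le_norm _ _)
    refine h1.trans ?_
    by_cases hk : freqNormSq k < K ^ 2
    · have hb : b k = 0 := by rw [hb]; simp only; rw [hlow k hk, norm_zero]
      rw [hb, mul_zero, mul_zero]
    · refine mul_le_mul_of_nonneg_right ?_ (hb0 k)
      rw [hc]; simp only
      rw [le_div_iff₀ hK]
      have hK' : K ≤ Real.sqrt (freqNormSq k) := by
        rw [← Real.sqrt_sq hK.le]; exact Real.sqrt_le_sqrt (not_lt.1 hk)
      calc a k * K ≤ a k * Real.sqrt (freqNormSq k) := mul_le_mul_of_nonneg_left hK' (ha0 k)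
        _ = Real.sqrt (freqNormSq k) * a k := mul_comm _ _
  have key := hS.norm_le_of_bounded hCsum hdom
  rw [Real.norm_eq_abs] at key
  have hAe : A = Real.sqrt (eGradNormSq v).toReal / (2 * Real.pi * K) := by
    rw [hA, Real.sqrt_div ENNReal.toReal_nonneg, show (4 * Real.pi ^ 2 : ℝ) = (2 * Real.pi) ^ 2 by ring,
      Real.sqrt_sq (by positivity), div_div]
  calc |∫ x, inner ℝ (v x) (h x)| ≤ C := key
    _ ≤ A * B := hCAB
    _ = _ := by rw [hAe]

omit [DecidableEq d] in
/-- The real integral `∫ ∑ⱼ ‖D j‖²` as the lower integral `∫⁻ ∑ⱼ ‖D j‖ₑ²` (all `D j ∈ L²`). [folklore] -/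
private theorem lintegral_sum_enorm_sq_eq_ofReal_integral {D : d → UnitAddTorus d → EuclideanSpace ℝ d} (hD : ∀ j, MemLp (D j) 2 volume) :
    ∫⁻ x, ∑ j, ‖D j x‖ₑ ^ 2 = ENNReal.ofReal (∫ x, ∑ j, ‖D j x‖ ^ 2) := by
  have hi : Integrable (fun x => ∑ j, ‖D j x‖ ^ 2) volume := integrable_finsetSum _ fun j _ => (hD j).integrable_norm_pow two_ne_zero
  rw [ofReal_integral_eq_lintegral_ofReal hi (Eventually.of_forall fun x => Finset.sum_nonneg fun j _ => sq_nonneg _)]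
  refine lintegral_congr fun x => ?_
  rw [ENNReal.ofReal_sum_of_nonneg fun j _ => sq_nonneg _]
  exact Finset.sum_congr rfl fun j _ => by rw [← ofReal_norm, ← ENNReal.ofReal_pow (norm_nonneg _)]

/-- **HIGH-MODE PAIRING (Poincaré) BOUND, weak-gradient form.**  For `v ∈ L²(T^d; ℝ^d)` with honest weak partial derivatives `D j ∈ L²` and
`h ∈ L²` whose Fourier coefficients vanish on `|k|² < K²` (`K > 0`):  `|∫⟪v, h⟫| ≤ √(∫∑ⱼ‖D j‖²) / (2πK) · √(∫‖h‖²)` — a field supported on high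
frequencies pairs with `v` only through `‖∇v‖₂/(2πK)`. [cite: Grafakos2014, Prop. 3.2.7 (3)] -/
theorem abs_integral_inner_le_of_hasWeakPartialDeriv_of_freqNormSq_lt {v h : UnitAddTorus d → EuclideanSpace ℝ d}
    {D : d → UnitAddTorus d → EuclideanSpace ℝ d} (hv : MemLp v 2 volume) (hD : ∀ j, MemLp (D j) 2 volume)
    (hw : ∀ j, HasWeakPartialDeriv j v (D j)) (hh : MemLp h 2 volume) {K : ℝ} (hK : 0 < K)
    (hlow : ∀ k : d → ℤ, freqNormSq k < K ^ 2 → mFourierCoeff (EuclideanSpace.complexify ∘ h) k = 0) :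
    |∫ x, inner ℝ (v x) (h x)| ≤ Real.sqrt (∫ x, ∑ j, ‖D j x‖ ^ 2) / (2 * Real.pi * K) * Real.sqrt (∫ x, ‖h x‖ ^ 2) := by
  have hE : eGradNormSq v = ENNReal.ofReal (∫ x, ∑ j, ‖D j x‖ ^ 2) := by
    rw [eGradNormSq_eq_lintegral_of_hasWeakPartialDeriv hv hD hw, lintegral_sum_enorm_sq_eq_ofReal_integral hD]
  have hgrad : eGradNormSq v ≠ ⊤ := by rw [hE]; exact ENNReal.ofReal_ne_top
  have key := abs_integral_inner_le_of_mFourierCoeff_eq_zero_of_freqNormSq_lt hv hh hgrad hK hlow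
  rwa [hE, ENNReal.toReal_ofReal (integral_nonneg fun x => Finset.sum_nonneg fun j _ => sq_nonneg _)] at key

end Torus

end Literature.Analysis.FluidPDE

end
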